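import Literature.NumberTheory.Automorphic.RankinSelbergSiegelFiniteness
import Literature.NumberTheory.Automorphic.AdelicHeightGLSiegel
import HarnessLib

/-!
# A rapidly decreasing function times a power of the height is integrable over a Siegel set

Topic `NumberTheory/Automorphic`; namespace `Literature.NumberTheory.Automorphic`. Proof file
(theorems only), a companion of `RankinSelbergSiegelFiniteness`: the pairing of a rapidly decreasing
function on a Siegel set of `GL_n(𝔸_K)` with a function of moderate growth converges
(Moeglin–Waldspurger (1995), I.2.2 (vii): `‖g‖` is polynomial in the torus parameter on Siegel
sets; I.2.18: rapidly decreasing functions against slowly increasing ones), in the form needed for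
the singular theta terms of Godement–Jacquet (1972), §12:

* `apply_zero_le_pow_mul_of_chain`, `first_div_last_le_pow_of_chain` — if consecutive ratios of
  `b ∈ (ℝ_{>0})ⁿ` are `≤ R` (`R ≥ 1`) then `b₀/b_{n-1} ≤ Rⁿ`;
* `setLIntegral_siegel_enorm_mul_height_rpow_lt_top` — **for a continuous rapidly decreasing `φ`
  (`IsRapidlyDecreasingGL`), `N ≥ 0`, a Haar measure `μ_G` and Siegel data `Z, Ω, t`:
  `∫_{Z Ω A_{T₀}(t) K} |φ(g)| (1 ⊔ ‖g‖)^N dμ_G(g) < ∞`** (`‖·‖ = adelicHeightGL`).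

## References

* C. Moeglin, J.-L. Waldspurger, *Spectral decomposition and Eisenstein series* (1995), I.2.2,
  I.2.18 [MoeglinWaldspurger1995].
* R. Godement, H. Jacquet, *Zeta functions of simple algebras*, LNM 260 (1972), §12
  [GodementJacquetLNM260].
-/

noncomputable section

open scoped NNReal ENNReal Pointwise Classical MatrixGroups
open NumberField NumberField.mixedEmbedding IsDedekindDomain Set MeasureTheory Measure Matrix Module

namespace Literature.NumberTheory.Automorphic

/-! ### The chain inequality on the torus -/

section Chain

variable {n : ℕ}

/-- **Chains of ratios**: if `b_i ≤ R b_{i+1}` for consecutive indices (`R ≥ 1`), then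
`b_0 ≤ R^k b_k`. [folklore] -/
theorem apply_zero_le_pow_mul_of_chain {b : Fin n → ℝ≥0ˣ} {R : ℝ} (hR1 : 1 ≤ R)
    (hR : ∀ i j : Fin n, (j : ℕ) = (i : ℕ) + 1 → ((b i : ℝ≥0) : ℝ) ≤ R * ((b j : ℝ≥0) : ℝ))
    (k : Fin n) : ((b ⟨0, lt_of_le_of_lt (Nat.zero_le _) k.2⟩ : ℝ≥0) : ℝ) ≤ R ^ (k : ℕ) * ((b k : ℝ≥0) : ℝ) := by
  obtain ⟨k, hk⟩ := k
  induction k with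
  | zero => simp
  | succ k ih =>
      have hk' : k < n := Nat.lt_of_succ_lt hk
      calc ((b ⟨0, _⟩ : ℝ≥0) : ℝ) ≤ R ^ k * ((b ⟨k, hk'⟩ : ℝ≥0) : ℝ) := ih hk'
        _ ≤ R ^ k * (R * ((b ⟨k + 1, hk⟩ : ℝ≥0) : ℝ)) :=
            mul_le_mul_of_nonneg_left (hR ⟨k, hk'⟩ ⟨k + 1, hk⟩ rfl) (pow_nonneg (zero_le_one.trans hR1) _)
        _ = R ^ (k + 1) * ((b ⟨k + 1, hk⟩ : ℝ≥0) : ℝ) := by ring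

/-- **First over last**: under the chain condition, `b_0 / b_{n-1} ≤ R^n` (`n ≥ 1`, `R ≥ 1`). [folklore] -/
theorem first_div_last_le_pow_of_chain (hn : 0 < n) {b : Fin n → ℝ≥0ˣ} {R : ℝ} (hR1 : 1 ≤ R)
    (hR : ∀ i j : Fin n, (j : ℕ) = (i : ℕ) + 1 → ((b i : ℝ≥0) : ℝ) ≤ R * ((b j : ℝ≥0) : ℝ)) :
    ((b ⟨0, hn⟩ : ℝ≥0) : ℝ) / ((b ⟨n - 1, by omega⟩ : ℝ≥0) : ℝ) ≤ R ^ n := by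
  have hlast : 0 < ((b ⟨n - 1, by omega⟩ : ℝ≥0) : ℝ) :=
    NNReal.coe_pos.2 (pos_iff_ne_zero.2 (b _).ne_zero)
  rw [div_le_iff₀ hlast]
  calc ((b ⟨0, hn⟩ : ℝ≥0) : ℝ) ≤ R ^ (n - 1) * ((b ⟨n - 1, by omega⟩ : ℝ≥0) : ℝ) :=
        apply_zero_le_pow_mul_of_chain hR1 hR ⟨n - 1, by omega⟩
    _ ≤ R ^ n * ((b ⟨n - 1, by omega⟩ : ℝ≥0) : ℝ) :=
        mul_le_mul_of_nonneg_right (pow_le_pow_right₀ hR1 (Nat.sub_le n 1)) hlast.le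

end Chain

/-! ### Finiteness over the Siegel set -/

section Finiteness

variable (n : ℕ) (K : Type) [Field K] [NumberField K]

/-- **A rapidly decreasing function times any power of the height is integrable over a Siegel set.**
For a Haar measure `μ_G` on `GL_n(𝔸_K)` (Borel σ-algebra, `n ≥ 1`), a continuous rapidly decreasing
`φ` (`IsRapidlyDecreasingGL`, Getz–Hahn Def. 9.3), `N ≥ 0` and Siegel data `Z ⊆ A_G` compact,
`Ω ⊆ B(𝔸_K)` compact, `t > 0`:

  `∫_{Z Ω A_{T₀}(t) K} |φ(g)| (1 ⊔ ‖g‖)^N dμ_G(g) < ∞`.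

The integrand is bounded on the Siegel set: writing `g = z ω a k = a · y`, `y = z (a⁻¹ ω a) k` in a
fixed compact `Y` (`exists_isCompact_conj_siegelCone_mem_of_subset`), one has
`‖g‖ ≤ n ‖a‖ ‖y‖`, `‖a‖ ≤ max(1, t⁻¹)^{2n} a₁/aₙ` (`adelicHeightGL_posRealDiagonal_le_of_siegelCone`),
`a₁/aₙ ≤ R^n` when consecutive ratios are `≤ R` (`first_div_last_le_pow_of_chain`), and
`|φ(a y)| ≤ C_φ R^{-B}` with `B = n N + 1` (`exists_uniform_rapidDecay`); the Siegel set has finite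
measure (`measure_mul_siegelSet_lt_top`). This is the moderate growth of `‖·‖^N` on Siegel sets
(Moeglin–Waldspurger (1995), I.2.2 (vii)) against rapid decay (ibid. I.2.18), as used in
Godement–Jacquet (1972), §12 for the singular theta terms. [cite: MoeglinWaldspurger1995, I.2.2] -/
theorem setLIntegral_siegel_enorm_mul_height_rpow_lt_top (hn : 0 < n)
    [MeasurableSpace (GL (Fin n) (AdeleRing (𝓞 K) K))] [BorelSpace (GL (Fin n) (AdeleRing (𝓞 K) K))]
    (μG : Measure (GL (Fin n) (AdeleRing (𝓞 K) K))) [μG.IsHaarMeasure]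
    {φ : (AdelicGroupData.gl n K).Adelic → ℂ} (hφc : Continuous φ) (hφ : IsRapidlyDecreasingGL n K φ)
    {N : ℝ} (hN : 0 ≤ N)
    {Ω : Set (GL (Fin n) (AdeleRing (𝓞 K) K))} (hΩc : IsCompact Ω)
    (hΩB : Ω ⊆ (standardParabolicGL (AdeleRing (𝓞 K) K) (id : Fin n → Fin n) :
      Set (GL (Fin n) (AdeleRing (𝓞 K) K))))
    {t : ℝ} (ht : 0 < t) {Z : Set (GL (Fin n) (AdeleRing (𝓞 K) K))} (hZc : IsCompact Z)
    (hZ : Z ⊆ Set.range (posRealScalar n K)) :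
    ∫⁻ g in Z * (Ω * siegelCone n K t *
        (standardMaximalCompactGL n K : Set (GL (Fin n) (AdeleRing (𝓞 K) K)))),
      (‖φ g‖ₑ : ℝ≥0∞) * ENNReal.ofReal ((1 ⊔ adelicHeightGL n K g) ^ N) ∂μG < ⊤ := by
  have hmeq := ‹BorelSpace (GL (Fin n) (AdeleRing (𝓞 K) K))›.measurable_eq
  subst hmeq
  letI : MeasurableSpace (GL (Fin n) (AdeleRing (𝓞 K) K)) := borel _
  haveI : T2Space (GL (Fin n) (AdeleRing (𝓞 K) K)) := t2Space_gl n K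
  haveI : NeZero n := ⟨hn.ne'⟩
  have hKc : IsCompact (standardMaximalCompactGL n K : Set (GL (Fin n) (AdeleRing (𝓞 K) K))) :=
    isCompact_standardMaximalCompactGL n K
  set S : Set (GL (Fin n) (AdeleRing (𝓞 K) K)) := Z * (Ω * siegelCone n K t *
    (standardMaximalCompactGL n K : Set (GL (Fin n) (AdeleRing (𝓞 K) K)))) with hS
  have hSm : MeasurableSet S := measurableSet_mul_siegelSet n K hZc hΩc ht
  have hSfin : μG S < ⊤ := measure_mul_siegelSet_lt_top μG hΩc hΩB ht hZc hZ
  set F : GL (Fin n) (AdeleRing (𝓞 K) K) → ℝ≥0∞ := fun g =>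
    (‖φ g‖ₑ : ℝ≥0∞) * ENNReal.ofReal ((1 ⊔ adelicHeightGL n K g) ^ N) with hF
  suffices hbd : ∃ Cst : ℝ≥0∞, Cst ≠ ⊤ ∧ ∀ g ∈ S, F g ≤ Cst by
    obtain ⟨Cst, hCst, hle⟩ := hbd
    calc ∫⁻ g in S, F g ∂μG ≤ ∫⁻ _g in S, Cst ∂μG := setLIntegral_mono' hSm fun g hg => hle g hg
      _ = Cst * μG S := setLIntegral_const _ _
      _ < ⊤ := ENNReal.mul_lt_top hCst.lt_top hSfin
  -- the compact set of conjugates, `Y = Z C K`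
  obtain ⟨CΩ, hCΩc, hconj⟩ := exists_isCompact_conj_siegelCone_mem_of_subset ht hΩB hΩc
  set Y : Set (GL (Fin n) (AdeleRing (𝓞 K) K)) := Z * CΩ *
    (standardMaximalCompactGL n K : Set (GL (Fin n) (AdeleRing (𝓞 K) K))) with hY
  have hYc : IsCompact Y := (hZc.mul hCΩc).mul hKc
  -- heights on `Y`
  obtain ⟨BY, hBY0, hBY⟩ := exists_adelicHeightGL_le_of_isCompact (n := n) (K := K) hYc
  -- rapid decay with `B = n N + 1`
  set B : ℝ := n * N + 1 with hB
  have hB0 : 0 < B := by positivity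
  obtain ⟨Cφ, hCφ0, hφb⟩ := exists_uniform_rapidDecay n K hφc hφ hYc ht hB0
  set T : ℝ := max 1 t⁻¹ with hT
  have hT1 : 1 ≤ T := le_max_left _ _
  set C₁ : ℝ := max 1 (n * T ^ (2 * n) * BY) with hC₁
  have hC₁1 : 1 ≤ C₁ := le_max_left _ _
  refine ⟨ENNReal.ofReal (Cφ * C₁ ^ N), ENNReal.ofReal_ne_top, fun g hg => ?_⟩
  -- decompose `g = z ω a k = a · (z (a⁻¹ ω a) k)`
  obtain ⟨z, hz, _, ⟨_, ⟨ω, hω, a, ha, rfl⟩, k, hk, rfl⟩, rfl⟩ := hg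
  obtain ⟨r, rfl⟩ := hZ hz
  obtain ⟨b, hprod, hroot, rfl⟩ := ha
  set a : GL (Fin n) (AdeleRing (𝓞 K) K) := posRealDiagonal n K b with ha'
  have hacone : a ∈ siegelCone n K t := ⟨b, hprod, hroot, rfl⟩
  set y : GL (Fin n) (AdeleRing (𝓞 K) K) := posRealScalar n K r * (a⁻¹ * ω * a) * k with hy
  have hyY : y ∈ Y := ⟨_, ⟨_, hz, _, hconj a hacone ω hω, rfl⟩, k, hk, rfl⟩
  have hzc : ∀ g : GL (Fin n) (AdeleRing (𝓞 K) K), g * posRealScalar n K r = posRealScalar n K r * g :=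
    fun g => Subgroup.mem_center_iff.1 (posRealScalar_mem_center n K r) g
  have hgy : posRealScalar n K r * (ω * a * k) = a * y := by
    rw [hy]
    calc posRealScalar n K r * (ω * a * k)
        = (a * a⁻¹) * posRealScalar n K r * ω * a * k := by rw [mul_inv_cancel, one_mul]; simp only [mul_assoc]
      _ = a * (posRealScalar n K r * (a⁻¹ * ω * a) * k) := by
          rw [mul_assoc a a⁻¹, hzc a⁻¹]
          simp only [mul_assoc]
  change F (posRealScalar n K r * (ω * a * k)) ≤ _
  rw [hgy]
  -- rapid decay at `a y`
  obtain ⟨R, hR1, hRroot, hφay⟩ := hφb b hprod hroot y hyY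
  have hR0 : 0 < R := one_pos.trans_le hR1
  -- the height at `a y`
  have hHa : adelicHeightGL n K a ≤ T ^ (2 * n) * R ^ n := by
    refine (adelicHeightGL_posRealDiagonal_le_of_siegelCone (K := K) ht hn hprod hroot).trans ?_
    exact mul_le_mul_of_nonneg_left (first_div_last_le_pow_of_chain hn hR1 hRroot) (by positivity)
  have hH : 1 ⊔ adelicHeightGL n K (a * y) ≤ C₁ * R ^ n := by
    refine max_le ?_ ?_
    · calc (1 : ℝ) = 1 * 1 := (mul_one 1).symm
        _ ≤ C₁ * R ^ n := mul_le_mul hC₁1 (one_le_pow₀ hR1) zero_le_one (zero_le_one.trans hC₁1)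
    · calc adelicHeightGL n K (a * y) ≤ n * adelicHeightGL n K a * adelicHeightGL n K y :=
            adelicHeightGL_mul_le_const a y
        _ ≤ n * (T ^ (2 * n) * R ^ n) * BY := by
            gcongr
            · exact adelicHeightGL_nonneg y
            · exact hBY y hyY
        _ = (n * T ^ (2 * n) * BY) * R ^ n := by ring
        _ ≤ C₁ * R ^ n := mul_le_mul_of_nonneg_right (le_max_right _ _) (by positivity)
  have hHN : (1 ⊔ adelicHeightGL n K (a * y)) ^ N ≤ C₁ ^ N * R ^ ((n : ℝ) * N) := by
    calc (1 ⊔ adelicHeightGL n K (a * y)) ^ N ≤ (C₁ * R ^ n) ^ N :=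
          Real.rpow_le_rpow (zero_le_one.trans le_sup_left) hH hN
      _ = C₁ ^ N * R ^ ((n : ℝ) * N) := by
          rw [Real.mul_rpow (zero_le_one.trans hC₁1) (pow_nonneg hR0.le _), ← Real.rpow_natCast R n,
            ← Real.rpow_mul hR0.le]
  -- assemble: `Cφ R^{-B} · C₁^N R^{nN} = Cφ C₁^N R^{nN - B} ≤ Cφ C₁^N`
  have hRB : R ^ (-B) * R ^ ((n : ℝ) * N) ≤ 1 := by
    rw [← Real.rpow_add hR0, hB]
    exact Real.rpow_le_one_of_one_le_of_nonpos hR1 (by linarith)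
  simp only [hF]
  rw [← ofReal_norm, ← ENNReal.ofReal_mul (norm_nonneg _)]
  refine ENNReal.ofReal_le_ofReal ?_
  calc ‖φ (a * y)‖ * (1 ⊔ adelicHeightGL n K (a * y)) ^ N
      ≤ (Cφ * R ^ (-B)) * (C₁ ^ N * R ^ ((n : ℝ) * N)) :=
        mul_le_mul hφay hHN (Real.rpow_nonneg (zero_le_one.trans le_sup_left) _)
          (mul_nonneg hCφ0 (Real.rpow_nonneg hR0.le _))
    _ = Cφ * C₁ ^ N * (R ^ (-B) * R ^ ((n : ℝ) * N)) := by ring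
    _ ≤ Cφ * C₁ ^ N * 1 := mul_le_mul_of_nonneg_left hRB (mul_nonneg hCφ0 (Real.rpow_nonneg (zero_le_one.trans hC₁1) _))
    _ = Cφ * C₁ ^ N := mul_one _

end Finiteness

end Literature.NumberTheory.Automorphic
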